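import Literature.Claims.NS.Zhirkin2016
import Literature.Analysis.FluidPDE.HessianLaplacian
import Literature.Analysis.FluidPDE.AxisymQuotientEquationsJ
import HarnessLib

/-!
# C53 `Zhirkin2016` — kernel refutations of the typed steps (cell `ns-claims`, D-0090)

Claim C53: A. V. Zhirkin, «Existence and properties of the Navier–Stokes equations», Cogent
Mathematics 3 (2016) 1190308 = arXiv:1608.07696 v1 (text of record; arXiv-PDF pages).
Skeleton: `Literature.Claims.NS.Zhirkin2016` (p478862, typist ns-claims-typist-3 g2).
Kernel author: ns-claims-refuter-7 (g0); filed by a salvage prover (cell convention (b)).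

Decided here (every statement is the NEGATION of a typed decl of the skeleton, named in full):

* `not_Step2_harmonicTwoVariables` — §2.3 p.7 ¶1–2 («The harmonic functions possess the property of
  completeness only for two variables …»), typed as: every smooth harmonic function on `ℝ³` is
  invariant along some non-zero direction. Witness `Φ(y) = y₀y₁ + y₂` (harmonic; invariant along no
  direction). FIRST failing step of the ordered index 1 → 2 → 3 → 4 → 5 → 6 → §4.
* `not_Step3_solenoidalTwoVariables` — §2.3 (33)–(38) p.7 + p.8 ¶1 («… there are only two
  independent spatial variables»), THE DECISIVE STEP: the ABC field `abc 1 1 1` of the tree is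
  smooth, divergence free and invariant along no direction (`not_isTwoVariable_abc`).
* `not_Step4_nonlinearVanishes` — §2.4 (39) p.8 («(v·∇)v = … = 0 because the condition k ⊥ v is
  performed for any k»): `((v·∇)v)(0) = (1,1,1) ≠ 0` for `v = abc 1 1 1` (cross terms between modes).
* `not_ClaimedMechanism` — §4 p.20 «For η > 0, the smooth solutions of the Navier-Stokes equations
  exist only in space of two variables»: the viscous ABC flow `e^{−νt} abc` (tree
  `isClassicalNSSolutionOn_abc`) is a smooth unforced classical solution on `ℝ³ × [0,∞)` whose
  time-0 velocity is invariant along no direction.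
* `not_ClaimedTheorem` — §4 p.20: the printed conjunction «(A), (B) have no solutions ∧ (C), (D) have
  no witness data» denies both members of the tree's whole-space dichotomy
  `ClayVariants.clayR3_regularity_or_exists_breakdownAt` (pure logic over the Clay schema).

WHAT THIS IS NOT: not a claim about NS regularity or blow-up; not a claim about any author beyond the
typed locator.
-/

noncomputable section

set_option linter.dupNamespace false

open Set Function Real
open scoped ContDiff Laplacian

namespace Summit.NavierStokesRegularity.NavierStokesRegularity.Theorems.Zhirkin2016

open Literature.Analysis.FluidPDE Literature.Analysis.FluidPDE.ABC Literature.Claims.NS.Zhirkin2016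

/-! ## Step 2 (§2.3 p.7 ¶1–2): a harmonic function of three genuine variables -/

/-- The witness against Step 2: `Φ(y) = y₀ y₁ + y₂` (a harmonic polynomial).
[cite: Zhirkin2016, §2.3 p.7 ¶1–2] -/
def zhPhi (y : EuclideanSpace ℝ (Fin 3)) : ℝ :=
  y 0 * y 1 + y 2

/-- `Φ` is smooth. [folklore] -/
theorem contDiff_zhPhi : ContDiff ℝ ∞ zhPhi :=
  (((EuclideanSpace.proj (𝕜 := ℝ) (0 : Fin 3)).contDiff).mul
    ((EuclideanSpace.proj (𝕜 := ℝ) (1 : Fin 3)).contDiff)).add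
    ((EuclideanSpace.proj (𝕜 := ℝ) (2 : Fin 3)).contDiff)

/-- `Φ` is harmonic: `Δ(y₀y₁) = y₀Δy₁ + y₁Δy₀ + 2 Σᵢ ∂ᵢy₀ ∂ᵢy₁ = 0` and `Δy₂ = 0`. [folklore] -/
theorem laplacian_zhPhi (x : EuclideanSpace ℝ (Fin 3)) : (Δ zhPhi) x = 0 := by
  have hc : ∀ i : Fin 3, ContDiff ℝ 2 (fun y : EuclideanSpace ℝ (Fin 3) => y i) := fun i =>
    (EuclideanSpace.proj (𝕜 := ℝ) i).contDiff
  have hd : ∀ (i : Fin 3) (y h : EuclideanSpace ℝ (Fin 3)),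
      fderiv ℝ (fun z : EuclideanSpace ℝ (Fin 3) => z i) y h = h i := by
    intro i y h
    have e : (fun z : EuclideanSpace ℝ (Fin 3) => z i) = ⇑(EuclideanSpace.proj (𝕜 := ℝ) i) := rfl
    rw [e, ContinuousLinearMap.fderiv]
    rfl
  have hsplit : zhPhi = (fun y : EuclideanSpace ℝ (Fin 3) => y 0 * y 1) +
      fun y : EuclideanSpace ℝ (Fin 3) => y 2 := rfl
  rw [hsplit, ContDiffAt.laplacian_add ((hc 0).mul (hc 1)).contDiffAt (hc 2).contDiffAt,
    laplacian_mul_eq (EuclideanSpace.basisFun (Fin 3) ℝ) (hc 0) (hc 1) x,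
    laplacian_coord_eq_zero 0 x, laplacian_coord_eq_zero 1 x, laplacian_coord_eq_zero 2 x]
  simp [hd]

/-- `Φ` is invariant along no direction: from `Φ(±e) = Φ(0)`, `Φ(e₁ + e) = Φ(e₁)` and
`Φ(e₀ + e) = Φ(e₀)` one reads off `e = 0`. [folklore] -/
theorem not_isTwoVariable_zhPhi : ¬ IsTwoVariable zhPhi := by
  rintro ⟨e, he, h⟩
  have h1 := h 0 1
  have h2 := h 0 (-1)
  have h3 := h (EuclideanSpace.single (1 : Fin 3) (1 : ℝ)) 1
  have h4 := h (EuclideanSpace.single (0 : Fin 3) (1 : ℝ)) 1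
  simp [zhPhi, mul_add, add_mul] at h1 h2 h3 h4
  have e2 : e 2 = 0 := by linarith
  have e0 : e 0 = 0 := by linarith
  have e1 : e 1 = 0 := by linarith
  exact he (by ext i; fin_cases i <;> simp [e0, e1, e2])

/-- **Step 2 is false** (§2.3 p.7 ¶1–2, typed: every smooth harmonic function on `ℝ³` is a
function of two spatial variables in some Cartesian frame): `Φ(y) = y₀y₁ + y₂` is smooth and
harmonic but invariant along no direction. [cite: Zhirkin2016, §2.3 p.7 ¶1–2] -/
theorem not_Step2_harmonicTwoVariables :
    ¬ Literature.Claims.NS.Zhirkin2016.Step2_harmonicTwoVariables := fun h =>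
  not_isTwoVariable_zhPhi (h zhPhi contDiff_zhPhi laplacian_zhPhi)

/-! ## Step 3 (§2.3 (33)–(38) p.7, p.8 ¶1): the ABC field is genuinely three-dimensional -/

/-- The ABC field `abc 1 1 1 = (sin x₃ + cos x₂, sin x₁ + cos x₃, sin x₂ + cos x₁)` is invariant
along no direction: invariance along `e` at the origin gives `sin(s eᵢ) = 0` for every `s` and each
`i`, hence `e = 0`. [cite: MajdaBertozziCUP2002, §2.3.2 Example 2.8 eq. (2.49)] -/
theorem not_isTwoVariable_abc : ¬ IsTwoVariable (abc 1 1 1) := by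
  rintro ⟨e, he, h⟩
  have key : ∀ a : ℝ, (∀ s : ℝ, sin (s * a) = 0) → a = 0 := by
    intro a ha
    by_contra hne
    have h' := ha (π / 2 / a)
    rw [div_mul_cancel₀ _ hne, sin_pi_div_two] at h'
    exact one_ne_zero h'
  have hc : ∀ (s : ℝ) (i : Fin 3),
      abc 1 1 1 ((0 : EuclideanSpace ℝ (Fin 3)) + s • e) i = abc 1 1 1 0 i := fun s i => by
    rw [h 0 s]
  have h0 : ∀ s : ℝ, sin (s * e 2) + cos (s * e 1) = 1 := fun s => by simpa using hc s 0
  have h1 : ∀ s : ℝ, sin (s * e 0) + cos (s * e 2) = 1 := fun s => by simpa using hc s 1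
  have h2 : ∀ s : ℝ, sin (s * e 1) + cos (s * e 0) = 1 := fun s => by simpa using hc s 2
  have hs2 : ∀ s : ℝ, sin (s * e 2) = 0 := fun s => by
    have a := h0 s
    have b := h0 (-s)
    rw [neg_mul, neg_mul, sin_neg, cos_neg] at b
    linarith
  have hs0 : ∀ s : ℝ, sin (s * e 0) = 0 := fun s => by
    have a := h1 s
    have b := h1 (-s)
    rw [neg_mul, neg_mul, sin_neg, cos_neg] at b
    linarith
  have hs1 : ∀ s : ℝ, sin (s * e 1) = 0 := fun s => by
    have a := h2 s
    have b := h2 (-s)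
    rw [neg_mul, neg_mul, sin_neg, cos_neg] at b
    linarith
  have e0 := key _ hs0
  have e1 := key _ hs1
  have e2 := key _ hs2
  exact he (by ext i; fin_cases i <;> simp [e0, e1, e2])

/-- **Step 3 is false** (§2.3 (33)–(38) p.7 + p.8 ¶1 «… there are only two independent spatial
variables», typed: every smooth divergence-free field on `ℝ³` is invariant along some non-zero
direction): the ABC field `abc 1 1 1` is smooth (`contDiff_abc`), divergence free
(`isDivFree_abc`) and invariant along no direction. `k ⊥ v̂(k)` removes one AMPLITUDE component
per Fourier mode, not a spatial variable of a superposition. [cite: Zhirkin2016, §2.3 eqs. (33)–(38) p.7 and p.8 ¶1] -/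
theorem not_Step3_solenoidalTwoVariables :
    ¬ Literature.Claims.NS.Zhirkin2016.Step3_solenoidalTwoVariables := fun h =>
  not_isTwoVariable_abc (h (abc 1 1 1) (contDiff_abc 1 1 1) (fun x => isDivFree_abc 1 1 1 x))

/-! ## Step 4 (§2.4 (39) p.8): the nonlinear term of the ABC field does not vanish -/

/-- **Step 4 is false** (§2.4 (39) p.8 «(v·∇)v = (v_SOL·∇)v_SOL ∼ (k′·v_SOL(t,k))·v_SOL(t,k′) = 0»,
typed: `(v·∇)v ≡ 0` for every smooth divergence-free `v` on `ℝ³`): for `v = abc 1 1 1`,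
`v(0) = (1,1,1)` and the first component of `((v·∇)v)(0) = Dv(0)[v(0)]` is
`∂₁v₁ + ∂₂v₁ + ∂₃v₁ = 0 + 0 + 1 = 1` (the cross term `k′·v̂(k) ≠ 0` between different modes).
[cite: Zhirkin2016, §2.4 eq. (39) p.8] -/
theorem not_Step4_nonlinearVanishes :
    ¬ Literature.Claims.NS.Zhirkin2016.Step4_nonlinearVanishes := by
  intro h4
  have h := h4 (abc 1 1 1) (contDiff_abc 1 1 1) (fun x => isDivFree_abc 1 1 1 x) 0
  have hv : abc 1 1 1 (0 : EuclideanSpace ℝ (Fin 3)) =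
      EuclideanSpace.single (0 : Fin 3) (1 : ℝ) + EuclideanSpace.single (1 : Fin 3) (1 : ℝ) +
        EuclideanSpace.single (2 : Fin 3) (1 : ℝ) := by
    ext i
    fin_cases i <;> simp
  have hc := congrArg (fun v : EuclideanSpace ℝ (Fin 3) => v 0) h
  simp only [convect] at hc
  rw [hv, map_add, map_add] at hc
  simp only [PiLp.add_apply, fderiv_abc_single, PiLp.zero_apply] at hc
  simp [jac] at hc

/-! ## §4 p.20: the claimed mechanism and the claimed theorem -/

/-- **The claimed mechanism is false** (§4 p.20 «For η > 0, the smooth solutions of the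
Navier-Stokes equations exist only in space of two variables»): the viscous ABC flow
`u(t,x) = e^{−νt} abc(x)`, `p = −½e^{−2νt}|abc|²` (tree `isClassicalNSSolutionOn_abc`, restricted to
`[0,∞)`) is a smooth unforced classical solution at `ν = 1` whose time-0 velocity `abc 1 1 1` is
invariant along no direction. [cite: Zhirkin2016, §4 p.20 ¶1] -/
theorem not_ClaimedMechanism : ¬ Literature.Claims.NS.Zhirkin2016.ClaimedMechanism := by
  intro h
  have hsol : IsClassicalNSSolutionOn (Ici (0 : ℝ)) 1 0 (strongBeltramiVelocity 1 1 (abc 1 1 1))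
      (strongBeltramiPressure 1 1 (abc 1 1 1)) :=
    (isClassicalNSSolutionOn_abc 1 1 1 1).mono (subset_univ _) (uniqueDiffOn_Ici 0)
  have h2 := h 1 one_pos _ _ hsol 0 le_rfl
  rw [strongBeltramiVelocity_zero] at h2
  exact not_isTwoVariable_abc h2

/-- **The claimed theorem is false as a statement** (§4 p.20: «There exist no smooth functions …
that satisfy the claims (A) or (B)» ∧ «there exists no smooth, divergence-free vector field …
satisfying (C) or (D)»): over the Clay schema the tree proves the one-sided dichotomy
`clayR3.Regularity ∨ ∃ ν > 0, clayR3.BreakdownAt ν`, and breakdown at one viscosity is (C)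
(`clayR3_breakdownAt_iff`, `clayR3_breakdown_iff`); the printed conjunction denies both members.
[cite: Zhirkin2016, §4 p.20 ¶1–2] -/
theorem not_ClaimedTheorem : ¬ Literature.Claims.NS.Zhirkin2016.ClaimedTheorem := by
  rintro ⟨hA, -, hC, -⟩
  rcases Literature.Claims.NS.ClayVariants.clayR3_regularity_or_exists_breakdownAt with h | ⟨ν, hν, hb⟩
  · exact hA h
  · exact hC (Literature.Claims.NS.ClayVariants.clayR3_breakdown_iff.mpr
      ((Literature.Claims.NS.ClayVariants.clayR3_breakdownAt_iff hν).mp hb))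

end Summit.NavierStokesRegularity.NavierStokesRegularity.Theorems.Zhirkin2016

end

-- WHAT THIS IS NOT: not a claim about NS regularity or blow-up; not a claim about any author beyond the typed locator.
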